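import Summits.ValiantsHypothesis.ValiantsHypothesis.Theorems.KPlusLogSqLawTropicalBThreeFiveBoundD

/-!
# Route «KPlusLogSqLaw», crux `TropicalB` (stmt-ValiantsHypothesis-19771) — certificate kit for the `(3,5)` row, part 3:
# the THREE-TERM EXCHANGE LAW as an order-type test (`domO3`) and its soundness

HONEST FRAMING.  Helper toward the registered stubs `stub_tropThin` / `stub_tropFat` of `Cruxes/TropicalB/Lines/birth.lean` (crux `TropicalB`,
item stmt-ValiantsHypothesis-19771; cell `pub-symmetroid`, seat val-sym-trop-p3 g10, 2026-08-28; `--supports … --as helper`).  Generic MACHINERY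
ONLY — no census value is claimed here.  It is the kernel side of this seat's located finding (memo HOME/val-sym-trop-p3/g10/FINDINGS):
on every sampled exponent order type of the `(3,5)` row, the cell's TWO order-level laws — the pairwise cyclewise exchange law (val-sym-trop-p4
g5's `domO` / `search`, `…ThreeFiveKit`) and the three-term exchange law (`MultiExchange.prefix_deficit` with `t = 3`, val-sym-trop-p4 g5,
p485928) — admit no schedule of `33` or more terms, while `32` is attained in the kernel (`…ThreeFiveThirtyTwo{,Signed}`: `31 ≤ T(3,5)`).  A
kernel proof of `T_D(3,5) ≤ 31` (hence `= 31`) along g5's route needs exactly the three pieces below plus a generated cell decomposition with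
per-cell pattern families (successor work).  Nothing here bears on `TropicalB` in its window, `WeakLifting`, DoorA26 / DoorA34,
`MatrixDescartes` (stmt-ValiantsHypothesis-18050) or VP ≠ VNP.

CONTENT (`m = 3`, `K = 5`; abstract terms `AT = (Fin 3 → Fin 3) × (Fin 3 → Fin 5)` as in `…ThreeFiveKit`).
* `Rel6`, `ge6` — known relations between sums of SIX exponents (two class triples a side), from two triple relations or a listed strict one;
  `sum_le_of_ge6`.
* `trans3`, `domO3 R3 R6 a b c` — THREE-TERM TEST for abstract terms `a, b, c` (in time order): some per-column re-partition of their nine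
  cells into three transversal terms `X₀, X₁, X₂` (valid row vectors, not the trivial re-partition) has `s(X₀) ≤ s(a)` and
  `s(X₀) + s(X₁) ≤ s(a) + s(b)` KNOWN from the relations.  `domO3_sound`: impossible for unique optima at `θa < θb < θc` — the three
  dominance inequalities against `X₀, X₁, X₂` (present terms: they only use cells of `a, b, c`) add up, valuations cancel column by column,
  and `e₀(θa − θb) + (e₀ + e₁)(θb − θc) > 0` contradicts `e₀, e₀ + e₁ ≥ 0` (`three_term_key`; this is `prefix_deficit` at `t = 3` with `0/1`
  Farkas multipliers, re-proved in the explicit form the test needs).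
(Sequel `…ThreeFiveBound3`: the combined refutation search `search3` with both tests, its soundness, the first-term row relabelling, and the
covering lemma «patterns avoided by every pair of histograms ⇒ `n ≤ 31`».)  [this cell; the law is the tree's, the packaging is new]
-/

set_option linter.dupNamespace false
set_option autoImplicit false

namespace Summit.ValiantsHypothesis.ValiantsHypothesis.Theorems.KPlusLogSqLaw

open Summit.ValiantsHypothesis.ValiantsHypothesis.Theorems.MatrixDescartes.Negative
open Summit.ValiantsHypothesis.ValiantsHypothesis.Theorems.LacunarySymmetroidMatrixDescartes.TropicalCensus
open Finset ForbiddenPatterns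

namespace ThreeFive

/-! ## 1. Six-sums -/

/-- a class triple. -/
abbrev T3 := Fin 5 × Fin 5 × Fin 5

/-- known strict relations between sums of six exponents: `((y₁,y₂),(x₁,x₂))` encodes `s(y₁) + s(y₂) < s(x₁) + s(x₂)` (triples sorted). -/
abbrev Rel6 := List ((T3 × T3) × (T3 × T3))

/-- the exponent sum of a class triple. -/
def s3 (d : Fin 5 → ℕ) (x : T3) : ℕ := d x.1 + d x.2.1 + d x.2.2

/-- `x₁, x₂` are known to have six-sum `≥` that of `y₁, y₂`: termwise by `ge3` (in either matching) or a listed strict relation. -/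
def ge6 (R3 : Rel3) (R6 : Rel6) (x₁ x₂ y₁ y₂ : T3) : Bool :=
  (ge3 R3 x₁ y₁ && ge3 R3 x₂ y₂) || (ge3 R3 x₁ y₂ && ge3 R3 x₂ y₁) ||
    decide (((sort3 y₁, sort3 y₂), (sort3 x₁, sort3 x₂)) ∈ R6) || decide (((sort3 y₂, sort3 y₁), (sort3 x₁, sort3 x₂)) ∈ R6) ||
    decide (((sort3 y₁, sort3 y₂), (sort3 x₂, sort3 x₁)) ∈ R6) || decide (((sort3 y₂, sort3 y₁), (sort3 x₂, sort3 x₁)) ∈ R6)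

/-- the classes of an abstract term as a triple. -/
def cls (a : AT) : T3 := (a.2 0, a.2 1, a.2 2)

section Sound6

variable (d : Fin 5 → ℕ) (R3 : Rel3) (R6 : Rel6)

/-- `s3` is invariant under `sort3`. -/
theorem s3_sort3 (x : T3) : s3 d (sort3 x) = s3 d x := sum_sort3 d x

/-- soundness of `ge6`. -/
theorem sum_le_of_ge6 (hmono : Monotone d)
    (hR3 : ∀ r ∈ R3, d r.1.1 + d r.1.2.1 + d r.1.2.2 < d r.2.1 + d r.2.2.1 + d r.2.2.2)
    (hR6 : ∀ r ∈ R6, s3 d r.1.1 + s3 d r.1.2 < s3 d r.2.1 + s3 d r.2.2)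
    (x₁ x₂ y₁ y₂ : T3) (h : ge6 R3 R6 x₁ x₂ y₁ y₂ = true) : s3 d y₁ + s3 d y₂ ≤ s3 d x₁ + s3 d x₂ := by
  unfold ge6 at h
  simp only [Bool.or_eq_true, Bool.and_eq_true, decide_eq_true_eq] at h
  have g3 : ∀ x y : T3, ge3 R3 x y = true → s3 d y ≤ s3 d x := fun x y hxy => sum_le_of_ge3 d R3 hmono hR3 x y hxy
  rcases h with ((((⟨h1, h2⟩ | ⟨h1, h2⟩) | h) | h) | h) | h
  · linarith [g3 _ _ h1, g3 _ _ h2]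
  · linarith [g3 _ _ h1, g3 _ _ h2]
  all_goals
    have k := hR6 _ h
    simp only [s3_sort3] at k
    linarith

end Sound6

/-! ## 2. The three-term test and its soundness -/

/-- the `i`-th transversal of three abstract terms `t 0, t 1, t 2` under per-column index permutations `π`: in column `j` it takes the cell
of term `t (π j i)`. -/
def trans3 (t : Fin 3 → AT) (π : Fin 3 → (Fin 3 → Fin 3)) (i : Fin 3) : AT :=
  (fun j => (t (π j i)).1 j, fun j => (t (π j i)).2 j)

/-- a row vector is a valid permutation vector (pairwise distinct rows). -/
def valid3 (x : AT) : Bool := decide (x.1 0 ≠ x.1 1 ∧ x.1 0 ≠ x.1 2 ∧ x.1 1 ≠ x.1 2)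

/-- **three-term test** for abstract terms `a, b, c` in time order: some re-partition of their cells into transversals `X₀, X₁, X₂` (valid,
not the trivial one) is KNOWN to satisfy `s(X₀) ≤ s(a)` and `s(X₀) + s(X₁) ≤ s(a) + s(b)`. -/
def domO3 (R3 : Rel3) (R6 : Rel6) (a b c : AT) : Bool :=
  S3V.any fun π0 => S3V.any fun π1 => S3V.any fun π2 =>
    valid3 (trans3 ![a, b, c] ![π0, π1, π2] 0) && valid3 (trans3 ![a, b, c] ![π0, π1, π2] 1) &&
    valid3 (trans3 ![a, b, c] ![π0, π1, π2] 2) &&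
    decide (¬ (trans3 ![a, b, c] ![π0, π1, π2] 0 = a ∧ trans3 ![a, b, c] ![π0, π1, π2] 1 = b ∧
      trans3 ![a, b, c] ![π0, π1, π2] 2 = c)) &&
    ge3 R3 (cls a) (cls (trans3 ![a, b, c] ![π0, π1, π2] 0)) &&
    ge6 R3 R6 (cls a) (cls b) (cls (trans3 ![a, b, c] ![π0, π1, π2] 0)) (cls (trans3 ![a, b, c] ![π0, π1, π2] 1))

section Sound3

variable (d : Fin 5 → ℕ) (v ε : Fin 3 → Fin 3 → Fin 5 → ℤ) (R2 : Rel2) (R3 : Rel3) (R6 : Rel6)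

/-- the arithmetic core of the three-term law (Abel summation for `t = 3`). [folklore] -/
theorem three_term_key (θa θb θc sP sQ sR sX sY sZ vP vQ vR vX vY vZ : ℤ) (hab : θa < θb) (hbc : θb < θc)
    (h1 : θa * sX - vX ≤ θa * sP - vP) (h2 : θb * sY - vY ≤ θb * sQ - vQ) (h3 : θc * sZ - vZ ≤ θc * sR - vR)
    (hstrict : θa * sX - vX < θa * sP - vP ∨ θb * sY - vY < θb * sQ - vQ ∨ θc * sZ - vZ < θc * sR - vR)
    (hV : vP + vQ + vR = vX + vY + vZ) (hS : sP + sQ + sR = sX + sY + sZ) (h6 : sX ≤ sP) (h7 : sX + sY ≤ sP + sQ) : False := by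
  have k1 : 0 ≤ (sP - sX) * (θb - θa) := mul_nonneg (by linarith) (by linarith)
  have k2 : 0 ≤ (sP + sQ - sX - sY) * (θc - θb) := mul_nonneg (by linarith) (by linarith)
  have k3 : θc * sR = θc * sX + θc * sY + θc * sZ - θc * sP - θc * sQ := by
    have : sR = sX + sY + sZ - sP - sQ := by linarith
    rw [this]; ring
  have e1 : (sP - sX) * (θb - θa) = θb * sP - θa * sP - θb * sX + θa * sX := by ring
  have e2 : (sP + sQ - sX - sY) * (θc - θb) = θc * sP + θc * sQ - θc * sX - θc * sY - θb * sP - θb * sQ + θb * sX + θb * sY := by ring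
  rw [e1] at k1
  rw [e2] at k2
  rcases hstrict with h | h | h <;> linarith

/-- a vector summed along one of the six permutation vectors. -/
theorem sum_perm3 (π : Fin 3 → Fin 3) (hπ : π ∈ S3V) (f : Fin 3 → ℤ) : f (π 0) + f (π 1) + f (π 2) = f 0 + f 1 + f 2 := by
  simp only [S3V, List.mem_cons, List.not_mem_nil, or_false] at hπ
  rcases hπ with rfl | rfl | rfl | rfl | rfl | rfl <;>
    simp only [Matrix.cons_val_zero, Matrix.cons_val_one, Matrix.cons_val] <;> ring

/-- an injective row vector of `Fin 3` is the vector of a permutation. -/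
theorem exists_perm_of_valid3 (x : AT) (h : valid3 x = true) : ∃ σ : Equiv.Perm (Fin 3), (⇑σ : Fin 3 → Fin 3) = x.1 := by
  have key : ∀ f : Fin 3 → Fin 3, decide (f 0 ≠ f 1 ∧ f 0 ≠ f 2 ∧ f 1 ≠ f 2) = true →
      ∃ σ : Equiv.Perm (Fin 3), (⇑σ : Fin 3 → Fin 3) = f := by
    decide
  exact key x.1 h

/-- a term all of whose cells are present is present. -/
theorem termSign_ne_zero_of_cells (q : Equiv.Perm (Fin 3) × (Fin 3 → Fin 5)) (h : ∀ j, ε (q.1 j) j (q.2 j) ≠ 0) :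
    termSign ε q ≠ 0 := by
  unfold termSign
  refine mul_ne_zero ?_ (prod_ne_zero_iff.mpr fun j _ => h j)
  exact_mod_cast (Equiv.Perm.sign q.1).ne_zero

/-- the cells of a present term are present. -/
theorem cell_ne_zero_of_termSign (q : Equiv.Perm (Fin 3) × (Fin 3 → Fin 5)) (h : termSign ε q ≠ 0) (j : Fin 3) :
    ε (q.1 j) j (q.2 j) ≠ 0 := by
  unfold termSign at h
  exact (prod_ne_zero_iff.mp (mul_ne_zero_iff.mp h).2) j (mem_univ j)

/-- the tropical weight of a `3 × 3` term, written out. -/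
theorem tropWeight_three (θ : ℤ) (q : Equiv.Perm (Fin 3) × (Fin 3 → Fin 5)) :
    tropWeight d v θ q = θ * ((d (q.2 0) : ℤ) + d (q.2 1) + d (q.2 2)) - (v (q.1 0) 0 (q.2 0) + v (q.1 1) 1 (q.2 1) + v (q.1 2) 2 (q.2 2)) := by
  unfold tropWeight
  rw [Fin.sum_univ_three, Fin.sum_univ_three]

/-- **soundness of `domO3`**: with `d` monotone and the listed relations true, no three unique optima at `θa < θb < θc` pass the test. -/
theorem domO3_sound (hmono : Monotone d)
    (hR3 : ∀ r ∈ R3, d r.1.1 + d r.1.2.1 + d r.1.2.2 < d r.2.1 + d r.2.2.1 + d r.2.2.2)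
    (hR6 : ∀ r ∈ R6, s3 d r.1.1 + s3 d r.1.2 < s3 d r.2.1 + s3 d r.2.2)
    {θa θb θc : ℤ} (hab : θa < θb) (hbc : θb < θc) (P Q R : Equiv.Perm (Fin 3) × (Fin 3 → Fin 5))
    (hP : IsDominant d v ε θa P) (hQ : IsDominant d v ε θb Q) (hR : IsDominant d v ε θc R)
    (h : domO3 R3 R6 (abs P) (abs Q) (abs R) = true) : False := by
  classical
  unfold domO3 at h
  simp only [List.any_eq_true, Bool.and_eq_true, decide_eq_true_eq] at h
  obtain ⟨π0, hπ0, π1, hπ1, π2, hπ2, ⟨⟨⟨⟨hv0, hv1⟩, hv2⟩, hnt⟩, hge3⟩, hge6⟩ := h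
  -- the three transversals as abstract terms and as terms
  set t : Fin 3 → AT := ![abs P, abs Q, abs R] with ht
  set π : Fin 3 → (Fin 3 → Fin 3) := ![π0, π1, π2] with hπ
  have hπmem : ∀ j, π j ∈ S3V := by
    intro j; fin_cases j
    · exact hπ0
    · exact hπ1
    · exact hπ2
  obtain ⟨σ0, hσ0⟩ := exists_perm_of_valid3 _ hv0
  obtain ⟨σ1, hσ1⟩ := exists_perm_of_valid3 _ hv1
  obtain ⟨σ2, hσ2⟩ := exists_perm_of_valid3 _ hv2
  set X0 : Equiv.Perm (Fin 3) × (Fin 3 → Fin 5) := (σ0, (trans3 t π 0).2) with hX0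
  set X1 : Equiv.Perm (Fin 3) × (Fin 3 → Fin 5) := (σ1, (trans3 t π 1).2) with hX1
  set X2 : Equiv.Perm (Fin 3) × (Fin 3 → Fin 5) := (σ2, (trans3 t π 2).2) with hX2
  have habs0 : abs X0 = trans3 t π 0 := by simp only [abs, X0, hσ0]
  have habs1 : abs X1 = trans3 t π 1 := by simp only [abs, X1, hσ1]
  have habs2 : abs X2 = trans3 t π 2 := by simp only [abs, X2, hσ2]
  -- the actual terms `T i` and the cells
  set T : Fin 3 → Equiv.Perm (Fin 3) × (Fin 3 → Fin 5) := ![P, Q, R] with hT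
  have htT : ∀ i, t i = abs (T i) := by intro i; fin_cases i <;> rfl
  have hpres : ∀ i j, ε ((T i).1 j) j ((T i).2 j) ≠ 0 := by
    intro i j
    fin_cases i
    · exact cell_ne_zero_of_termSign ε P hP.1 j
    · exact cell_ne_zero_of_termSign ε Q hQ.1 j
    · exact cell_ne_zero_of_termSign ε R hR.1 j
  -- cells of the transversals: row and class in column `j` come from `T (π j i)`
  have hrow : ∀ (i j : Fin 3) (σ : Equiv.Perm (Fin 3)), (⇑σ : Fin 3 → Fin 3) = (trans3 t π i).1 →
      σ j = (T (π j i)).1 j := by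
    intro i j σ hσ
    have := congrFun hσ j
    rw [this]
    simp only [trans3, htT, abs]
  have hcls : ∀ i j : Fin 3, (trans3 t π i).2 j = (T (π j i)).2 j := by
    intro i j; simp only [trans3, htT, abs]
  have hX0pres : termSign ε X0 ≠ 0 :=
    termSign_ne_zero_of_cells ε X0 fun j => by rw [show X0.1 j = (T (π j 0)).1 j from hrow 0 j σ0 hσ0,
      show X0.2 j = (T (π j 0)).2 j from hcls 0 j]; exact hpres _ _
  have hX1pres : termSign ε X1 ≠ 0 :=
    termSign_ne_zero_of_cells ε X1 fun j => by rw [show X1.1 j = (T (π j 1)).1 j from hrow 1 j σ1 hσ1,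
      show X1.2 j = (T (π j 1)).2 j from hcls 1 j]; exact hpres _ _
  have hX2pres : termSign ε X2 ≠ 0 :=
    termSign_ne_zero_of_cells ε X2 fun j => by rw [show X2.1 j = (T (π j 2)).1 j from hrow 2 j σ2 hσ2,
      show X2.2 j = (T (π j 2)).2 j from hcls 2 j]; exact hpres _ _
  -- dominance inequalities (weak always, strict unless the transversal is the term itself)
  have hle : ∀ (θ : ℤ) (Tm X : Equiv.Perm (Fin 3) × (Fin 3 → Fin 5)), IsDominant d v ε θ Tm → termSign ε X ≠ 0 →
      tropWeight d v θ X ≤ tropWeight d v θ Tm ∧ (X ≠ Tm → tropWeight d v θ X < tropWeight d v θ Tm) := by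
    intro θ Tm X hTm hX
    by_cases hXT : X = Tm
    · subst hXT; exact ⟨le_rfl, fun h => (h rfl).elim⟩
    · exact ⟨(hTm.2 X hXT hX).le, fun _ => hTm.2 X hXT hX⟩
  obtain ⟨h1, h1s⟩ := hle θa P X0 hP hX0pres
  obtain ⟨h2, h2s⟩ := hle θb Q X1 hQ hX1pres
  obtain ⟨h3, h3s⟩ := hle θc R X2 hR hX2pres
  -- not all three transversals are the terms themselves
  have hstrict : tropWeight d v θa X0 < tropWeight d v θa P ∨ tropWeight d v θb X1 < tropWeight d v θb Q ∨
      tropWeight d v θc X2 < tropWeight d v θc R := by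
    by_contra hcon
    push Not at hcon
    obtain ⟨k1, k2, k3⟩ := hcon
    have e0 : X0 = P := by by_contra hx; exact absurd (h1s hx) (not_lt.mpr k1)
    have e1 : X1 = Q := by by_contra hx; exact absurd (h2s hx) (not_lt.mpr k2)
    have e2 : X2 = R := by by_contra hx; exact absurd (h3s hx) (not_lt.mpr k3)
    apply hnt
    refine ⟨?_, ?_, ?_⟩
    · rw [← habs0, e0]
    · rw [← habs1, e1]
    · rw [← habs2, e2]
  -- column-by-column cancellation of valuations and slopes
  have hVS : ∀ (f : Fin 3 → Fin 3 → Fin 5 → ℤ),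
      (∑ j : Fin 3, f (X0.1 j) j (X0.2 j)) + (∑ j : Fin 3, f (X1.1 j) j (X1.2 j)) + (∑ j : Fin 3, f (X2.1 j) j (X2.2 j)) =
        (∑ j : Fin 3, f (P.1 j) j (P.2 j)) + (∑ j : Fin 3, f (Q.1 j) j (Q.2 j)) + (∑ j : Fin 3, f (R.1 j) j (R.2 j)) := by
    intro f
    have hcol : ∀ j : Fin 3, f (X0.1 j) j (X0.2 j) + f (X1.1 j) j (X1.2 j) + f (X2.1 j) j (X2.2 j) =
        f (P.1 j) j (P.2 j) + f (Q.1 j) j (Q.2 j) + f (R.1 j) j (R.2 j) := by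
      intro j
      rw [show X0.1 j = (T (π j 0)).1 j from hrow 0 j σ0 hσ0, show X0.2 j = (T (π j 0)).2 j from hcls 0 j,
        show X1.1 j = (T (π j 1)).1 j from hrow 1 j σ1 hσ1, show X1.2 j = (T (π j 1)).2 j from hcls 1 j,
        show X2.1 j = (T (π j 2)).1 j from hrow 2 j σ2 hσ2, show X2.2 j = (T (π j 2)).2 j from hcls 2 j]
      have key : f ((T (π j 0)).1 j) j ((T (π j 0)).2 j) + f ((T (π j 1)).1 j) j ((T (π j 1)).2 j) +
          f ((T (π j 2)).1 j) j ((T (π j 2)).2 j) = f ((T 0).1 j) j ((T 0).2 j) + f ((T 1).1 j) j ((T 1).2 j) +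
          f ((T 2).1 j) j ((T 2).2 j) := sum_perm3 (π j) (hπmem j) (fun i => f ((T i).1 j) j ((T i).2 j))
      rw [key]
      simp [hT]
    simp only [Fin.sum_univ_three]
    linarith [hcol 0, hcol 1, hcol 2]
  have hV := hVS v
  have hS := hVS (fun _ _ l => (d l : ℤ))
  -- the known slope relations
  have h6 : s3 d (cls (trans3 t π 0)) ≤ s3 d (cls (abs P)) := sum_le_of_ge3 d R3 hmono hR3 _ _ hge3
  have h7 := sum_le_of_ge6 d R3 R6 hmono hR3 hR6 _ _ _ _ hge6
  simp only [s3, cls, ← habs0, ← habs1, abs] at h6 h7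
  -- assemble
  have w0 := tropWeight_three d v θa X0
  have wP := tropWeight_three d v θa P
  have w1 := tropWeight_three d v θb X1
  have wQ := tropWeight_three d v θb Q
  have w2 := tropWeight_three d v θc X2
  have wR := tropWeight_three d v θc R
  simp only [Fin.sum_univ_three] at hV hS
  refine three_term_key θa θb θc
    ((d (P.2 0) : ℤ) + d (P.2 1) + d (P.2 2)) ((d (Q.2 0) : ℤ) + d (Q.2 1) + d (Q.2 2)) ((d (R.2 0) : ℤ) + d (R.2 1) + d (R.2 2))
    ((d (X0.2 0) : ℤ) + d (X0.2 1) + d (X0.2 2)) ((d (X1.2 0) : ℤ) + d (X1.2 1) + d (X1.2 2)) ((d (X2.2 0) : ℤ) + d (X2.2 1) + d (X2.2 2))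
    (v (P.1 0) 0 (P.2 0) + v (P.1 1) 1 (P.2 1) + v (P.1 2) 2 (P.2 2)) (v (Q.1 0) 0 (Q.2 0) + v (Q.1 1) 1 (Q.2 1) + v (Q.1 2) 2 (Q.2 2))
    (v (R.1 0) 0 (R.2 0) + v (R.1 1) 1 (R.2 1) + v (R.1 2) 2 (R.2 2))
    (v (X0.1 0) 0 (X0.2 0) + v (X0.1 1) 1 (X0.2 1) + v (X0.1 2) 2 (X0.2 2)) (v (X1.1 0) 0 (X1.2 0) + v (X1.1 1) 1 (X1.2 1) + v (X1.1 2) 2 (X1.2 2))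
    (v (X2.1 0) 0 (X2.2 0) + v (X2.1 1) 1 (X2.2 1) + v (X2.1 2) 2 (X2.2 2))
    hab hbc (by linarith) (by linarith) (by linarith) ?_ hV.symm hS.symm (by exact_mod_cast h6) (by exact_mod_cast h7)
  rcases hstrict with h | h | h
  · exact Or.inl (by linarith)
  · exact Or.inr (Or.inl (by linarith))
  · exact Or.inr (Or.inr (by linarith))

end Sound3

end ThreeFive

end Summit.ValiantsHypothesis.ValiantsHypothesis.Theorems.KPlusLogSqLaw
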